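import Summits.CriticalPhenomena.CardyFormulaZ2.Theses.CardyQContinuation
import Literature.Probability.LatticeModels.RectilinearPolyomino
import Literature.Probability.LatticeModels.FKIsingQuadrilateralCrossing
import Literature.Probability.LatticeModels.HoleFreePotential
import Literature.Probability.RandomPlanarGeometry.PolygonalDomains

/-!
# Crux `IsingJetsConformal` (route `CardyQContinuation`), line `registered` —
# stub `stub_loopSymmetricLimit_rectilinearPolyomino` (D1a)

The polyomino of a RECTILINEAR simple closed polygon at small mesh. In the `n = 0` sandwich of
the crux the comparison quadrilaterals are the polyominoes of designed rectilinear simple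
polygons `P`: for small `δ` the set `F` of unit squares of `δℤ²` whose closed faces lie in
`closure P` is nonempty, hole-free (`HoleFree`) and side-connected (the input of the `IsRect`
producer), its faces cover the `2δ`-interior of `P`, and the edge set `E` of all sides of its
squares is induced, pinch-free and diagonal-contact-free (the Chelkak–Smirnov sub-class
`IsCSQuadrilateral`), with every vertex carrying a missing lattice edge `2δ`-close to `∂P`
(convergence `csDomain → P`).

All the geometry is in the Literature support files landed with this stub:
`Literature/Probability/RandomPlanarGeometry/RectilinearPolygonGrid.lean` (probe lemma,
monochromatic boxes, no crosses, pinch exclusion for rectilinear simple polygons) and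
`Literature/Probability/LatticeModels/RectilinearPolyomino.lean` (rows / columns / corner
lemmas for `F`, the `E`-properties, covering, hole-freeness via shadowing walks of squares in
the exterior, side-connectivity via anchored shadowing walks in `P`), packaged as
`Literature.Probability.LatticeModels.RectilinearPolyomino.exists_mesh_polyomino` with
`δ₀ = min (g / 16) (r₀ / 2)` (`g` the grid gap of the vertex coordinates, `r₀` the radius of a
disc inside `P`).
-/

open scoped Topology
open Filter Set

namespace Summit.CriticalPhenomena.CardyFormulaZ2.Theorems.CardyQContinuation

/-- **D1a: the polyomino of a rectilinear simple polygon at small mesh.** For a rectilinear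
simple closed polygon `l` there is `δ₀ > 0` such that for `0 < δ < δ₀` the face set `F` of
`δ`-squares inside `closure (polygonDomain l h)` is nonempty, hole-free, side-connected and
covers the `2δ`-interior, and the edge set of all sides of its squares is induced, has no pinch
vertex and no diagonal contact, while vertices with a missing lattice edge are `2δ`-close to the
frontier (`RectilinearPolyomino.exists_mesh_polyomino`). -/
theorem stub_loopSymmetricLimit_rectilinearPolyomino :
    (∀ (l : List ℂ) (h : Literature.Probability.RandomPlanarGeometry.IsSimpleClosedPolygon l), (∀ (k : ℕ) (hk : k < l.length), (l[k]).re = (l[(k + 1) % l.length]'(Nat.mod_lt _ h.pos)).re ∨ (l[k]).im = (l[(k + 1) % l.length]'(Nat.mod_lt _ h.pos)).im) → ∃ δ₀ : ℝ, 0 < δ₀ ∧ ∀ δ : ℝ, 0 < δ → δ < δ₀ → ∀ (F : Finset (Literature.Probability.LatticeModels.Site 2)), (∀ s, s ∈ F ↔ Literature.Probability.LatticeModels.DiscreteRect.closedSq δ s ⊆ closure (Literature.Probability.RandomPlanarGeometry.polygonDomain l h).carrier) → F.Nonempty ∧ Literature.Probability.LatticeModels.HoleFree (↑F : Set (Literature.Probability.LatticeModels.Site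 2)) ∧ (∀ s ∈ F, ∀ t ∈ F, Relation.ReflTransGen (fun a b : Literature.Probability.LatticeModels.Site 2 ↦ a ∈ F ∧ b ∈ F ∧ (Literature.Probability.LatticeModels.zdGraph 2).Adj a b) s t) ∧ (∀ z ∈ (Literature.Probability.RandomPlanarGeometry.polygonDomain l h).carrier, 2 * δ ≤ Metric.infDist z (frontier (Literature.Probability.RandomPlanarGeometry.polygonDomain l h).carrier) → ∃ s ∈ F, z ∈ Literature.Probability.LatticeModels.DiscreteRect.closedSq δ s) ∧ ∀ (E : Finset (Sym2 (Literature.Probability.LatticeModels.Site 2))), (∀ e, e ∈ E ↔ ∃ s ∈ F, ∃ j : Fin 4, e = s(Literature.Probability.LatticeModels.DiscreteRect.corner s j, Literature.Probability.LatticeModels.DiscreteRect.corner s j + Literature.Probability.LatticeModels.DiscreteRect.dir j)) → (∀ x ∈ Literature.Probability.LatticeModels.DiscreteRect.verts E, ∀ k : Fin 4, x + Literature.Probability.LatticeModels.DiscreteRect.dir k ∈ Literature.Probability.LatticeModels.DiscreteRect.verts E → s(x, x + Literature.Probability.LatticeModels.DiscreteRect.dir k) ∈ E) ∧ (∀ x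 ∈ Literature.Probability.LatticeModels.DiscreteRect.verts E, ∀ k : Fin 4, Literature.Probability.LatticeModels.DiscreteRect.InF E (Literature.Probability.LatticeModels.DiscreteRect.quad x k) → Literature.Probability.LatticeModels.DiscreteRect.InF E (Literature.Probability.LatticeModels.DiscreteRect.quad x (k + 2)) → Literature.Probability.LatticeModels.DiscreteRect.InF E (Literature.Probability.LatticeModels.DiscreteRect.quad x (k + 1)) ∨ Literature.Probability.LatticeModels.DiscreteRect.InF E (Literature.Probability.LatticeModels.DiscreteRect.quad x (k + 3))) ∧ (∀ x ∈ Literature.Probability.LatticeModels.DiscreteRect.verts E, ∀ k : Fin 4, x + Literature.Probability.LatticeModels.DiscreteRect.dir k + Literature.Probability.LatticeModels.DiscreteRect.dir (k + 1) ∈ Literature.Probability.LatticeModels.DiscreteRect.verts E → x + Literature.Probability.LatticeModels.DiscreteRect.dir k ∈ Literature.Probability.LatticeModels.DiscreteRect.verts E ∨ x + Literature.Probability.LatticeModels.DiscreteRect.dir (k + 1) ∈ Literature.Probability.LatticeModels.DiscreteRect.verts E) ∧ (∀ x ∈ Literature.Probability.LatticeModels.DiscreteRect.verts E, (∃ k :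 Fin 4, s(x, x + Literature.Probability.LatticeModels.DiscreteRect.dir k) ∉ E) → Metric.infDist (Literature.Probability.LatticeModels.meshPoint δ x) (frontier (Literature.Probability.RandomPlanarGeometry.polygonDomain l h).carrier) ≤ 2 * δ)) :=
  fun l h hrect ↦
    Literature.Probability.LatticeModels.RectilinearPolyomino.exists_mesh_polyomino l h hrect

end Summit.CriticalPhenomena.CardyFormulaZ2.Theorems.CardyQContinuation
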